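import Literature.NumberTheory.EllipticCurves.KrizLi2019.TwoPartBSDTwists
import Literature.NumberTheory.EllipticCurves.Zhai2021.TwoAdicLowerBoundTwists
import HarnessLib

/-!
# Kriz–Li 2019 (FMS 7, e15), §6 Table 1 («Assumption (★) for rank one curves») — the rows `101a1`, `131a1`, `163a1` AS PRINTED:
# for the optimal curves `E ∈ {101a1, 131a1}` with `K = ℚ(√−23)` and `E = 163a1` with `K = ℚ(√−7)`, Assumption (★) holds (statement-only named
# facts; the per-curve inputs of Thm 5.1 (2) = `thm112_bsdTwo_twist` at three PRIME-conductor rank-one rows with `c₂(E) = 1`)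

HONEST FRAMING (cell `bsd-f1-sign2`, seat `bsd-line-gk2-p2` g34, crux U₂ `MinimalTwinBSDTwo` stmt-BirchSwinnertonDyer-22985, LINE 23
«twin_swap»; 2026-08-31): three PUBLISHED per-curve computational assertions (check-marks in a table of a refereed paper) vendored as named
`Prop`s — nothing asserted, nothing discharged (D-0014) — with a locator into the held source; companions of `KrizLi2019.table1_row37a1/43a1`
(`Table1RankOneRows37a1And43a1.lean`, this seat), `table1_row92b1` (seat `bsd-2adic-k4-w2`) and `table1_row243a1` (the CM row), in the SAME shape
(optimal parametrisation datum transcribed because Example 6.2 searches «rank one OPTIMAL elliptic curves»; all three curves are GOOD at `2`, so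
consumers of Thm 5.1 (2) may ignore the optimality conjunct).  For these rows the companion `E^{(d_K)}` has conductor `d_K²·N > 5000` (`23²·101`,
`23²·131`, `7²·163`), outside Creutz–Miller's range: the consumer (`…KrizLiAnchorWall.lean`) takes the companion's `BSD(2)` from the rank-zero WALL and
only the base's from Creutz–Miller (`N ≤ 163 < 5000`).  Everything else about the rows (`E(ℚ)[2] = 0`, a point of infinite order, the Heegner
hypothesis, `c₂ = 1`, `N`) is decided IN THE KERNEL by the consumer.  Nothing is booked here; BSD is not proved by any of this.

Source. D. Kriz, C. Li, *Goldfeld's conjecture and congruences between Heegner points*, Forum Math. Sigma **7** (2019), e15,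
doi:10.1017/fms.2019.9 [KrizLi2019] = arXiv:1606.03172 (§§1–6). Texts read: the held chunk text `paper:doi-10-1017-fms-2019-9` (p0017 L21: Example
6.2), which DROPS the table body; the table itself was read in the arXiv v3 source `Congruence.tex` (copy at
`run/shared/lean/pub/bsd-print-cf2/lit/krizli2019/arXiv-1606.03172v3-Congruence.tex`), ll. 964–1017 (`\label{tab:1}`, Example 6.2), rows at
lines 977 (`101a1 & -23 & 1 & \checkmark`), 981 (`131a1 & -23 & 1 & \checkmark`) and 991 (`163a1 & -7 & 1 & \checkmark`).

## The printed statement (verbatim)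

* Example 6.2 (tex l. 965): "We search for rank one optimal elliptic curves with `E(ℚ)[2] = 0` satisfying these two necessary conditions. There
  are 38 such curves of conductor `≤ 300`. For each curve, we choose `K` with smallest `|d_K|` satisfying the Heegner hypothesis for `N` and such
  that `2` is split in `K`. Then 31 out of 38 curves satisfy (★). See Table 1. The first three columns list `E`, `d_K` and the local Tamagawa
  number `c₂(E)` at `2` respectively. A check-mark in the last column means that (★) holds … If `c₂(E)` is further odd (true for 23 out of 31),
  then the application to BSD(2) (Theorem 5.1) also applies."
* Table 1, caption "Assumption (★) for rank one curves", header `E | d_K | c₂(E) | ★`, rows: "`37a1 & -7 & 1 & ✓`", …, "**`101a1 & -23 & 1 & ✓`**",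
  "`123a1 & -23 & 1 & ✓`", "`123b1 & -23 & 1 & ✓`", "`124a1 & -15 & 3 & ✓`", "**`131a1 & -23 & 1 & ✓`**", …, "`155c1 & -79 & 1 & ✓`",
  "**`163a1 & -7 & 1 & ✓`**", "`172a1 & -7 & 3 & ✓`", ….

## Transcription (tree dictionary of `KrizLi2019/TwoPartBSDTwists.lean`)

`E = 101a1` = Cremona's globally minimal model `y² + y = x³ + x² − x − 1` = `[0, 1, 1, −1, −1]` (`Δ = 101`, `N = 101`); `E = 131a1` = `y² + y =
x³ − x² + x` = `[0, −1, 1, 1, 0]` (`Δ = −131`, `N = 131`; the tree's `HeegnerLogTransport.KL3X3EInstances.G131a1`); `E = 163a1` = `y² + y = x³ − 2x + 1`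
= `[0, 0, 1, −2, 1]` (`Δ = −163`, `N = 163`; the tree's `KolyvaginDepthDoor…SecondSign11` curve `C163a1`).  "`K = ℚ(√d_K)`" = any `K` with
`IsImaginaryQuadratic K` and `NumberField.discr K = d_K` (`−23`, `−23`, `−7`).  "Optimal curve with its parametrisation" = a datum
`Dt : ModularParametrizationData E N` at the conductor level (`NeZero` witness packed) with `Zhai2021.IsOptimalDatum E Dt`; "(★) holds" = a Heegner
datum `H`, an embedding `ι`, a point `P ∈ E(K)` mapping to `heegnerPointComplex Dt H`, and `j : K →ₐ[ℚ] ℚ₂` with `AssumptionStar E Dt K P j`.  Global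
minimality of the printed model is a binder `[IsGloballyMinimal]`.  "Rank one", "`E(ℚ)[2] = 0`", "`c₂(E) = 1`" are NOT transcribed (kernel-side in
the consumer).  Nothing weaker or stronger is transcribed; no `_holds` is expected.  Status: PUB (refereed); per-curve computational TABLE entries,
flag word for the referee: TABLE.

## References
* [KrizLi2019] §6 Example 6.2 and Table 1 (rows 101a1, 131a1, 163a1) (FMS chunk p0017 L21; arXiv:1606.03172v3 `Congruence.tex` ll. 965, 977, 981,
  990); Assumption (★) (arXiv p0003 L45–L48); Thm 5.1 (2) = arXiv Thm 1.12.
* [CremonaAlgorithms1997] Table 1 (curves 101A1 = `[0,1,1,−1,−1]`, 131A1 = `[0,−1,1,1,0]`, 163A1 = `[0,0,1,−2,1]`).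
* [Zhai2021BSDExactFormulaTwists] §1 (the optimality predicate `IsOptimalDatum`).
-/

noncomputable section

open scoped Classical

open NumberField WeierstrassCurve Literature.NumberTheory.EllipticCurves
  Literature.NumberTheory.EllipticCurves.ModularForms

namespace Literature.NumberTheory.EllipticCurves.KrizLi2019

/-- **Kriz–Li 2019, §6 Table 1, row `101a1`** (verbatim in the module docstring: `101a1 | d_K = −23 | c₂(E) = 1 | ★ ✓`; Example 6.2): for every imaginary
quadratic field `K` of discriminant `−23`, the optimal curve `101a1` on its (globally minimal) model `[0,1,1,−1,−1]` (`y² + y = x³ + x² − x − 1`) admits an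
OPTIMAL modular parametrisation datum `Dt` at level `N(E)`, a Heegner datum `H` of discriminant `d_K` and level `N(E)`, an embedding `ι : K → ℂ`, a point
`P ∈ E(K)` mapping to `heegnerPointComplex Dt H`, and `j : K → ℚ₂` with `AssumptionStar E Dt K P j`.  Statement only; TABLE entry; no `_holds` expected.
[cite: KrizLi2019, §6 Table 1 (row 101a1) and Example 6.2 (FMS 7 (2019) e15, chunk p0017 L21; arXiv:1606.03172v3 Congruence.tex ll. 965, 977)] -/
def table1_row101a1 : Prop :=
  ∀ [(⟨0, 1, 1, -1, -1⟩ : WeierstrassCurve ℚ).IsGloballyMinimal]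
    (K : Type) [Field K] [NumberField K], IsImaginaryQuadratic K → NumberField.discr K = -23 →
    ∃ (_ : NeZero ((⟨0, 1, 1, -1, -1⟩ : WeierstrassCurve ℚ).conductorNorm ℤ))
      (Dt : ModularParametrizationData (⟨0, 1, 1, -1, -1⟩ : WeierstrassCurve ℚ)
        ((⟨0, 1, 1, -1, -1⟩ : WeierstrassCurve ℚ).conductorNorm ℤ))
      (H : HeegnerDatum ((⟨0, 1, 1, -1, -1⟩ : WeierstrassCurve ℚ).conductorNorm ℤ) (NumberField.discr K))
      (ι : K →+* ℂ) (P : ((⟨0, 1, 1, -1, -1⟩ : WeierstrassCurve ℚ).baseChange K).toAffine.Point)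
      (j : K →ₐ[ℚ] ℚ_[2]),
      Zhai2021.IsOptimalDatum (⟨0, 1, 1, -1, -1⟩ : WeierstrassCurve ℚ) Dt ∧
        WeierstrassCurve.Affine.Point.map ι.toRatAlgHom P = heegnerPointComplex Dt H ∧
          AssumptionStar (⟨0, 1, 1, -1, -1⟩ : WeierstrassCurve ℚ) Dt K P j

/-- **Kriz–Li 2019, §6 Table 1, row `131a1`** (verbatim in the module docstring: `131a1 | d_K = −23 | c₂(E) = 1 | ★ ✓`; Example 6.2): for every imaginary
quadratic field `K` of discriminant `−23`, the optimal curve `131a1` on its (globally minimal) model `[0,−1,1,1,0]` (`y² + y = x³ − x² + x`) admits an OPTIMAL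
modular parametrisation datum `Dt` at level `N(E)`, a Heegner datum `H` of discriminant `d_K` and level `N(E)`, an embedding `ι : K → ℂ`, a point
`P ∈ E(K)` mapping to `heegnerPointComplex Dt H`, and `j : K → ℚ₂` with `AssumptionStar E Dt K P j`.  Statement only; TABLE entry; no `_holds` expected.
[cite: KrizLi2019, §6 Table 1 (row 131a1) and Example 6.2 (FMS 7 (2019) e15, chunk p0017 L21; arXiv:1606.03172v3 Congruence.tex ll. 965, 981)] -/
def table1_row131a1 : Prop :=
  ∀ [(⟨0, -1, 1, 1, 0⟩ : WeierstrassCurve ℚ).IsGloballyMinimal]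
    (K : Type) [Field K] [NumberField K], IsImaginaryQuadratic K → NumberField.discr K = -23 →
    ∃ (_ : NeZero ((⟨0, -1, 1, 1, 0⟩ : WeierstrassCurve ℚ).conductorNorm ℤ))
      (Dt : ModularParametrizationData (⟨0, -1, 1, 1, 0⟩ : WeierstrassCurve ℚ)
        ((⟨0, -1, 1, 1, 0⟩ : WeierstrassCurve ℚ).conductorNorm ℤ))
      (H : HeegnerDatum ((⟨0, -1, 1, 1, 0⟩ : WeierstrassCurve ℚ).conductorNorm ℤ) (NumberField.discr K))
      (ι : K →+* ℂ) (P : ((⟨0, -1, 1, 1, 0⟩ : WeierstrassCurve ℚ).baseChange K).toAffine.Point)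
      (j : K →ₐ[ℚ] ℚ_[2]),
      Zhai2021.IsOptimalDatum (⟨0, -1, 1, 1, 0⟩ : WeierstrassCurve ℚ) Dt ∧
        WeierstrassCurve.Affine.Point.map ι.toRatAlgHom P = heegnerPointComplex Dt H ∧
          AssumptionStar (⟨0, -1, 1, 1, 0⟩ : WeierstrassCurve ℚ) Dt K P j

/-- **Kriz–Li 2019, §6 Table 1, row `163a1`** (verbatim in the module docstring: `163a1 | d_K = −7 | c₂(E) = 1 | ★ ✓`; Example 6.2): for every imaginary
quadratic field `K` of discriminant `−7`, the optimal curve `163a1` on its (globally minimal) model `[0,0,1,−2,1]` (`y² + y = x³ − 2x + 1`) admits an OPTIMAL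
modular parametrisation datum `Dt` at level `N(E)`, a Heegner datum `H` of discriminant `d_K` and level `N(E)`, an embedding `ι : K → ℂ`, a point
`P ∈ E(K)` mapping to `heegnerPointComplex Dt H`, and `j : K → ℚ₂` with `AssumptionStar E Dt K P j`.  Statement only; TABLE entry; no `_holds` expected.
[cite: KrizLi2019, §6 Table 1 (row 163a1) and Example 6.2 (FMS 7 (2019) e15, chunk p0017 L21; arXiv:1606.03172v3 Congruence.tex ll. 965, 991)] -/
def table1_row163a1 : Prop :=
  ∀ [(⟨0, 0, 1, -2, 1⟩ : WeierstrassCurve ℚ).IsGloballyMinimal]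
    (K : Type) [Field K] [NumberField K], IsImaginaryQuadratic K → NumberField.discr K = -7 →
    ∃ (_ : NeZero ((⟨0, 0, 1, -2, 1⟩ : WeierstrassCurve ℚ).conductorNorm ℤ))
      (Dt : ModularParametrizationData (⟨0, 0, 1, -2, 1⟩ : WeierstrassCurve ℚ)
        ((⟨0, 0, 1, -2, 1⟩ : WeierstrassCurve ℚ).conductorNorm ℤ))
      (H : HeegnerDatum ((⟨0, 0, 1, -2, 1⟩ : WeierstrassCurve ℚ).conductorNorm ℤ) (NumberField.discr K))
      (ι : K →+* ℂ) (P : ((⟨0, 0, 1, -2, 1⟩ : WeierstrassCurve ℚ).baseChange K).toAffine.Point)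
      (j : K →ₐ[ℚ] ℚ_[2]),
      Zhai2021.IsOptimalDatum (⟨0, 0, 1, -2, 1⟩ : WeierstrassCurve ℚ) Dt ∧
        WeierstrassCurve.Affine.Point.map ι.toRatAlgHom P = heegnerPointComplex Dt H ∧
          AssumptionStar (⟨0, 0, 1, -2, 1⟩ : WeierstrassCurve ℚ) Dt K P j

end Literature.NumberTheory.EllipticCurves.KrizLi2019

end
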